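import Mathlib
import Literature.Barriers.ValiantsHypothesis.AlgebraicNaturalProofs
import Summits.ValiantsHypothesis.ValiantsHypothesis.Theorems.BarrierLeverSuccinctHittingSetsForVPSparse
import HarnessLib

/-!
# Crux `BarrierLever.SuccinctHittingSetsForVP` (stmt-ValiantsHypothesis-14610), line `registered` —
THE CRUX IS EQUIVALENT TO ITS SUPER-DENSE LEVEL-ONE CASE
(distinguishers with more than `2^(n^(b-3))` monomials — exponentially more monomials than gates)

**What is proved (unconditional; a REDUCTION of the open stub, it does NOT close the item).** By the
landed master form of the sparse half (`Sparse.isSuccinctHittingSet_card_support_lt_of_le`, p152812: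
for `n ≥ 2` and `n³ + t(2n+2) + 1 ≤ n^b`, `SmallCircuits ℂ n b` hits every nonzero polynomial in the
`N = C(2n,n)` coefficient variables with `< 2^(t+1)` monomials) the size exponent `b` that a
hypothetical succinct hitting set uses ALREADY disposes of every distinguisher with at most
`2^(n^(b-3))` monomials (`Sparse.budget_pow`: `t = n^(b-3)` fits the budget for `n, b ≥ 4`). Hence:

* `SuperDense.levelOne_at_of_superDense` : for `n, b ≥ 4`, if `SmallCircuits ℂ n b` hits the level-one
  distinguishers with MORE than `2^(n^(b-3))` monomials, it hits ALL level-one distinguishers;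
* `levelOne_iff_superDense`, `succinctHittingSetsForVP_iff_superDense` : FSV Question 6 over `ℂ` in
  the tree's regime (the crux, every level) holds iff for some `b`, eventually in `n`,
  `SmallCircuits ℂ n b` hits every nonzero `D` with `L(D) ≤ N`, `deg D ≤ N` and more than
  `2^(n^(b-3))` monomials (registered open stub `stub_superDense`; the reduction is the registered
  stub `stub_levelOneOfSuperDense`). Since `N < 4^n`, for `b ≥ 5` these residual distinguishers have
  at most `N` gates but more than `2^(n²) > N^(n/2)` monomials: what remains open of Question 6 here
  concerns only circuits whose number of monomials is super-polynomial (indeed `exp`) in their size.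

This sharpens the landed `succinctHittingSetsForVP_iff_dense` (threshold `N`). Axioms: `propext`,
`Classical.choice`, `Quot.sound`. References: [ForbesShpilkaVolk2018] Question 6, Thm. 9, Lemma 32,
Cor. 34.
-/

-- layout Summits/ValiantsHypothesis/ValiantsHypothesis forces the duplicated namespace component
set_option linter.dupNamespace false

namespace Summit.ValiantsHypothesis.ValiantsHypothesis.Theorems.BarrierLever.SuccinctHittingSetsForVP

open Literature.Barriers.ValiantsHypothesis Literature.Computability.AlgebraicComplexity MvPolynomial

namespace SuperDense

/-- **At a fixed `n`**: for `n, b ≥ 4`, hitting the level-one distinguishers with more than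
`2^(n^(b-3))` monomials by `SmallCircuits ℂ n b` already gives all of level one at `n` — the others
have `< 2^(n^(b-3)+1)` monomials and are hit by the landed sparse master theorem with `t = n^(b-3)`.
[cite: ForbesShpilkaVolk2018, Lemma 32 and Cor. 34] -/
theorem levelOne_at_of_superDense {n b : ℕ} (hn : 4 ≤ n) (hb : 4 ≤ b)
    (h : IsSuccinctHittingSet (degLEMonomials n) (SmallCircuits ℂ n b)
      (Distinguishers ℂ n 1 ∩ {D | 2 ^ (n ^ (b - 3)) < D.support.card})) :
    IsSuccinctHittingSet (degLEMonomials n) (SmallCircuits ℂ n b) (Distinguishers ℂ n 1) := by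
  intro D hD hD0
  by_cases hc : 2 ^ (n ^ (b - 3)) < D.support.card
  · exact h D ⟨hD, hc⟩ hD0
  · have hlt : D.support.card < 2 ^ (n ^ (b - 3) + 1) :=
      lt_of_le_of_lt (not_lt.mp hc) (Nat.pow_lt_pow_right (by norm_num) (Nat.lt_succ_self _))
    exact Sparse.isSuccinctHittingSet_card_support_lt_of_le (by omega) (Sparse.budget_pow hn hb) D hlt hD0

/-- The residual class shrinks and the simple class grows with `b` (`n ≥ 1`). [folklore] -/
theorem superDense_mono {n b b' : ℕ} (hbb' : b ≤ b') (hn : 1 ≤ n)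
    (h : IsSuccinctHittingSet (degLEMonomials n) (SmallCircuits ℂ n b)
      (Distinguishers ℂ n 1 ∩ {D | 2 ^ (n ^ (b - 3)) < D.support.card})) :
    IsSuccinctHittingSet (degLEMonomials n) (SmallCircuits ℂ n b')
      (Distinguishers ℂ n 1 ∩ {D | 2 ^ (n ^ (b' - 3)) < D.support.card}) := by
  refine h.mono (smallCircuits_mono ℂ hbb' hn) ?_
  rintro D ⟨hD, hc⟩
  have hc' : 2 ^ (n ^ (b' - 3)) < D.support.card := hc
  have hle : 2 ^ (n ^ (b - 3)) ≤ 2 ^ (n ^ (b' - 3)) :=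
    Nat.pow_le_pow_right (by norm_num) (Nat.pow_le_pow_right hn (by omega))
  exact ⟨hD, lt_of_le_of_lt hle hc'⟩

end SuperDense

open SuperDense

/-- **Level one from its super-dense case.** [cite: ForbesShpilkaVolk2018, Question 6 and Cor. 34] -/
theorem levelOne_of_superDense
    (h : ∃ b n₀ : ℕ, ∀ n : ℕ, n₀ ≤ n →
      IsSuccinctHittingSet (degLEMonomials n) (SmallCircuits ℂ n b)
        (Distinguishers ℂ n 1 ∩ {D | 2 ^ (n ^ (b - 3)) < D.support.card})) :
    ∃ b n₀ : ℕ, ∀ n : ℕ, n₀ ≤ n →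
      IsSuccinctHittingSet (degLEMonomials n) (SmallCircuits ℂ n b) (Distinguishers ℂ n 1) := by
  obtain ⟨b, n₀, h⟩ := h
  refine ⟨max b 4, max n₀ 4, fun n hn => ?_⟩
  have hn₀ : n₀ ≤ n := le_trans (le_max_left _ _) hn
  have hn4 : 4 ≤ n := le_trans (le_max_right _ _) hn
  exact levelOne_at_of_superDense hn4 (le_max_right b 4)
    (superDense_mono (le_max_left b 4) (by omega) (h n hn₀))

/-- Conversely level one trivially gives its super-dense case. [folklore] -/
theorem superDense_of_levelOne
    (h : ∃ b n₀ : ℕ, ∀ n : ℕ, n₀ ≤ n →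
      IsSuccinctHittingSet (degLEMonomials n) (SmallCircuits ℂ n b) (Distinguishers ℂ n 1)) :
    ∃ b n₀ : ℕ, ∀ n : ℕ, n₀ ≤ n →
      IsSuccinctHittingSet (degLEMonomials n) (SmallCircuits ℂ n b)
        (Distinguishers ℂ n 1 ∩ {D | 2 ^ (n ^ (b - 3)) < D.support.card}) := by
  obtain ⟨b, n₀, h⟩ := h
  exact ⟨b, n₀, fun n hn => (h n hn).mono le_rfl Set.inter_subset_left⟩

/-- **Level one ⟺ its super-dense case.** [cite: ForbesShpilkaVolk2018, Question 6 and Cor. 34] -/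
theorem levelOne_iff_superDense :
    (∃ b n₀ : ℕ, ∀ n : ℕ, n₀ ≤ n →
      IsSuccinctHittingSet (degLEMonomials n) (SmallCircuits ℂ n b) (Distinguishers ℂ n 1)) ↔
    ∃ b n₀ : ℕ, ∀ n : ℕ, n₀ ≤ n →
      IsSuccinctHittingSet (degLEMonomials n) (SmallCircuits ℂ n b)
        (Distinguishers ℂ n 1 ∩ {D | 2 ^ (n ^ (b - 3)) < D.support.card}) :=
  ⟨superDense_of_levelOne, levelOne_of_superDense⟩

/-- **THE CRUX IS EQUIVALENT TO ITS SUPER-DENSE LEVEL-ONE CASE.** FSV Question 6 over `ℂ` in the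
tree's regime (`BarrierLever.SuccinctHittingSetsForVP`, every level `a`) holds iff for some `b`,
eventually in `n`, `SmallCircuits ℂ n b` hits every nonzero `D` in the `N = C(2n,n)` coefficient
variables with `L(D) ≤ N`, `deg D ≤ N` and MORE THAN `2^(n^(b-3))` monomials.
[cite: ForbesShpilkaVolk2018, Question 6 and Cor. 34] -/
theorem succinctHittingSetsForVP_iff_superDense :
    Summit.ValiantsHypothesis.ValiantsHypothesis.Theses.BarrierLever.SuccinctHittingSetsForVP ↔
      ∃ b n₀ : ℕ, ∀ n : ℕ, n₀ ≤ n →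
        IsSuccinctHittingSet (degLEMonomials n) (SmallCircuits ℂ n b)
          (Distinguishers ℂ n 1 ∩ {D | 2 ^ (n ^ (b - 3)) < D.support.card}) :=
  succinctHittingSetsForVP_iff_levelOne.trans levelOne_iff_superDense

/-- **Registered stub `stub_levelOneOfSuperDense`** (crux stmt-ValiantsHypothesis-14610, line
`registered`; the reduction of level one to its super-dense case, arrow form used by the skeleton's
composition). [cite: ForbesShpilkaVolk2018, Question 6 and Cor. 34] -/
theorem stub_levelOneOfSuperDense :
    (∃ b n₀ : ℕ, ∀ n : ℕ, n₀ ≤ n →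
      IsSuccinctHittingSet (degLEMonomials n) (SmallCircuits ℂ n b)
        (Distinguishers ℂ n 1 ∩ {D | 2 ^ (n ^ (b - 3)) < D.support.card})) →
    ∃ b n₀ : ℕ, ∀ n : ℕ, n₀ ≤ n →
      IsSuccinctHittingSet (degLEMonomials n) (SmallCircuits ℂ n b) (Distinguishers ℂ n 1) :=
  levelOne_of_superDense

end Summit.ValiantsHypothesis.ValiantsHypothesis.Theorems.BarrierLever.SuccinctHittingSetsForVP
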